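import Mathlib
import Summits.QuantumFields.BalabanUV.Beta.AnalyticWalkSum216RowResolvent
import Literature.MathematicalPhysics.QuantumFieldTheory.Balaban1983to89.B9SectECov

/-!
# [Balaban1985BackgroundPropagators] (3.186) p. 432 «G̃₂ = G₂ − G₂Q̃*(Q̃G₂Q̃*)⁻¹Q̃G₂» ∕ [Balaban1988RG2Cluster] p. 13 «G̃₃(x),
# which is defined as G̃₂, but with this additional operator» — RIDER (ρ1) OF ROUTE A.3′ ELIMINATED: run the Woodbury
# recombination ON THE CONSTRAINED COVARIANCE G̃₂ itself (b09's `B9SectECov.flucCov_add_tilt`, in the tree), so that the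
# END-TO-END theorem's sum at s ≡ 1 IS `flucCov (K + Rᵀ(x·1)R) Q̃` = the G̃₃(x) of [II] p. 13 — no projection inverse
# (Q̃G₃(x)Q̃*)⁻¹ is ever expanded (cell topic `Summits/QuantumFields/BalabanUV/Beta`; row-D4 rider (ρ3)/(ρ1); siblings
# `AnalyticWalkSum216RowResolvent(Omega)`)

HONEST FRAMING (cell rule).  Discharging `BetaPertH` makes Bałaban's UV stability UNCONDITIONAL — a real constructive-QFT
result; NOT the continuum limit, NOT the Clay problem.  This module discharges NOTHING of `BetaPertH`.  [folklore]
bookkeeping.  THE POINT (a records-level correction of the row's own outline, OUTLINE-D4-NODE-A §3b rider (ρ1), and of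
census §10.24 (r1)): route A.3′ was written with the UNCONSTRAINED covariance G₂ («(G₂⁻¹ + xQ̂*Q̂)⁻¹ = G₂ − xG₂Q̂*(1 +
xQ̂G₂Q̂*)⁻¹Q̂G₂») and therefore owed, as rider (ρ1), a walk expansion of the x-DEPENDENT projection inverse
(Q̃G₃(x)Q̃*)⁻¹ of (3.186).  But the tilt `x‖χ(QA + D̄μ(QA))‖²` of [II] p. 13 is a finite-rank update of the form about the
SAME δ-constraint, and the CONSTRAINED Woodbury identity (b09 gen 13, `B9SectECov.flucCov_add_tilt`, [folklore], in the
tree since 2026-08-19) reads `G̃₃(x) = flucCov (K + Rᵀ(x·1)R) Q̃ = G̃₂ − x·G̃₂Rᵀ(1 + x·RG̃₂Rᵀ)⁻¹RG̃₂`: THEOREM A∕B of the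
siblings apply VERBATIM with the `G`-family := the decorated pieces of G̃₂'s own expansion — which is exactly what [13]
Thm 3.15 ∕ (3.185) speaks about («This propagator has a convergent random walk expansion») — and the unit-lattice kernel
`R·G̃₂·Rᵀ`.  So after this file route A.3′ reads: (T2)-shape for G̃₃(x) ⇐ `rowData_resolventΩ`[(T3) := row data of
G̃₂'s decorated pieces, R_A, A2, (ρ2)] with the identification `termSum_resolventΩ_flucCov` below; rider (ρ1) is VOID on
this route (the co-owner's `UnitLatticeProjectionWalk.projectionWalkInversion` stays valid and unused here).  What this
needs that THEOREM B's identification `termSum_resolventΩ_one` did not allow: `Σ_ω G_ω = G̃₂` is SINGULAR (`Q̃G̃₂ = 0`), so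
the sum is stated in the Woodbury RIGHT-HAND form (no `(Σ_ωG_ω)⁻¹`).  Nothing of Bałaban's operators is instantiated
((T3) and NODE O.2 untouched); NO class change on any GAPS row; readiness width 0 unchanged; NOT summit progress.
Unit `b2b-balaban-beta-an4-g38` (owner of `BINDER-OWNERS.md` row D4); `GAPS.md` C-an4-93.

CITATION HEADER (lean-in-tree rule).  [13] = T. Bałaban, *Propagators for lattice gauge theories in a background field*,
Commun. Math. Phys. **99**, 389–434 (1985) [Balaban1985BackgroundPropagators], p. 432 [PDF 44] (quoted verbatim in
`B9Eq3185`'s header, render `1985-cmp99-background-propagators-p044-x2.png` read there as an image): *"Let us denote a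
covariance operator of the Gaussian integral in (3.183) by G̃₂, then we obtain C^{(k)}(Λ) = (I + D̄μ)QG̃₂Q*(I + μ*D̄*).
(3.185) … G̃₂ = G₂ − G₂Q̃*(Q̃G₂Q̃*)^{−1}Q̃G₂. (3.186)"*; [II] = T. Bałaban, *Renormalization group approach to lattice gauge
field theories. II*, Commun. Math. Phys. **116**, 1–22 (1988) [Balaban1988RG2Cluster], p. 13 [PDF 13]: *"the operator
C(xI + C*Δ_kC)⁻¹C* is representated by the integral (3.185) [13] with the additional term −½x‖χ*(QA + D̄μ(QA))‖² under
the exponential function … with the operator G̃₂ replaced by G̃₃(x), which is defined as G̃₂, but with this additional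
operator."*  Nothing printed is asserted; the displays LOCATE `flucCov` (= G̃₂, b09 `B9Eq3185.eq_3185`) and its tilt
(= G̃₃(x), b09 `B9SectECov.b10_rep63_of_3185`).

WHAT IS CERTIFIED HERE (kernel, sorry-free; [folklore]).
§1 `termSum_resolvent_eq` — THEOREM A's sum in Woodbury RIGHT-HAND form, NO invertibility of `G(σ)`:
   `termSum fam σ = G(σ) − x·(G(σ)·(P(1 + x·QG(σ)P)⁻¹Q)·G(σ))` (`termSum_recomb'` + `termSum_sandwich` BY NAME).
§2 `flucCov_tilt_eq` — b09's `flucCov_add_tilt` at `V = x·1` in the siblings' shape: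
   `flucCov (K + Rᵀ(x·1)R) Q̃ = 𝒢 − x·(𝒢(Rᵀ(1 + x·R𝒢Rᵀ)⁻¹R)𝒢)`, `𝒢 = flucCov K Q̃` (hypotheses: bordered matrix
   nonsingular, `x ≠ 0`, `1 + x·R𝒢Rᵀ` invertible); `termSum_resolvent_flucCov` — THEOREM A level: if the `G`-family sums
   to `flucCov K Q̃` then the recombined family sums to `flucCov (K + Rᵀ(x·1)R) Q̃`.
§3 **`termSum_resolventΩ_flucCov`** — THEOREM B level (the siblings' binders; `P := Rᵀ`, `Q := R`; `Σ_ω G_ω = flucCov K Q̃`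
   in place of «`Σ_ω G_ω` invertible»): at `s ≡ 1` the END-TO-END family SUMS to `flucCov (K + Rᵀ(x·1)R) Q̃` = G̃₃(x).
§4 Non-vacuity at THEOREM A level.
NOT CLAIMED.  Any expansion of Bałaban's G̃₂ (hypothesis `hG` = (T3), now INCLUDING the (3.186)∕A.4.5 projection step
that [13] p. 432 puts inside Thm 3.15's own expansion); positivity of the (3.183) form on ker Q̃ (implicit in «covariance»;
b09's hypothesis); k-uniformity (NODE O.2).  NOT summit progress.
PRIOR ART IN THE TREE (searched 2026-08-20): `B9SectECov` §6 (b09 gen 13: `flucCov_add_tilt`, `obs_flucCov_add_tilt`,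
`b10_rep63_of_3185` — the constrained Woodbury and B10 (63) as its consequence; USED BY NAME, nothing re-derived);
`Beta.CompositionSingular.flucCov`∕`Beta.Composition.kkt` (the bordered-inverse blocks); the siblings;
`UnitLatticeProjectionWalk` (d4-p3: rider (ρ1) the hard way — valid, not needed here).
-/

namespace Summit.QuantumFields.BalabanUV.Beta.AnalyticWalkSum216RowResolventProj

open Metric Set
open scoped Matrix
open Literature.MathematicalPhysics.QuantumFieldTheory.Balaban1983to89
open B13PerturbativeStep (WRS WeightHyp wrs)
open Literature.MathematicalPhysics.QuantumFieldTheory.Balaban1983to89.Beta.Composition (kkt)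
open Literature.MathematicalPhysics.QuantumFieldTheory.Balaban1983to89.Beta.CompositionSingular (flucCov)
open Literature.MathematicalPhysics.QuantumFieldTheory.Balaban1983to89.B9SectECov (flucCov_add_tilt)
open Summit.QuantumFields.BalabanUV.Beta.AnalyticWalkSum216 (termSum majSum)
open Summit.QuantumFields.BalabanUV.Beta.AnalyticWalkSum216Recomb (recombTerm recombMaj RIdx inv_smul_one
  inv_smul_one_add isUnit_inv_smul_one_add)
open Summit.QuantumFields.BalabanUV.Beta.AnalyticWalkSum216RowData (RowData)
open Summit.QuantumFields.BalabanUV.Beta.AnalyticWalkSum216RowNeumann (termSum_recomb')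
open Summit.QuantumFields.BalabanUV.Beta.AnalyticWalkSum216RowResolvent
open Summit.QuantumFields.BalabanUV.Beta.UnitLatticeWalkInversion (Hd Pj Ptot)
open Summit.QuantumFields.BalabanUV.Beta.UnitLatticeOmegaTerms
open Summit.QuantumFields.BalabanUV.Beta.UnitLatticeOmegaTube (listLen listLen_nonneg decΩ)
open Summit.QuantumFields.BalabanUV.Beta.UnitLatticeOmegaPaths
open Summit.QuantumFields.BalabanUV.Beta.UnitLatticeOmegaRowData

noncomputable section

variable {Y : Type*} [Fintype Y] [DecidableEq Y] {W V : Type*} {κ : ℝ} {d : Y → Y → ℝ} {R : ℝ}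

/-! ## §1 THEOREM A's sum in Woodbury right-hand form (no invertibility of `G`) -/

section SumForm

variable {TG : W → ℂ → Matrix Y Y ℂ} {mG : W → Y → Y → ℝ} {ρG : ℝ}
  {TΩ : V → ℂ → Matrix Y Y ℂ} {mΩ : V → Y → Y → ℝ} {ρΩ : ℝ} {P Q : Matrix Y Y ℂ} {cP cQ : ℝ}

/-- **The recombined family's sum, RIGHT-HAND FORM**: if the unit-lattice family sums to `(1 + x·QG(σ)P)⁻¹` then
`termSum fam σ = G(σ) − x·(G(σ)·(P(1 + x·QG(σ)P)⁻¹Q)·G(σ))` — `termSum_recomb'` + `termSum_sandwich` BY NAME; `G(σ)` may be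
singular. [folklore] -/
theorem termSum_resolvent_eq [Nonempty Y] (hG : RowData κ d R TG mG ρG) (hΩ : RowData κ d R TΩ mΩ ρΩ)
    (hP : WRS κ d P cP) (hQ : WRS κ d Q cQ) (hw : WeightHyp κ d) (hR : 0 < R) (x : ℂ) {σ : ℂ}
    (hσ : σ ∈ ball (0 : ℂ) R) (hΩsum : termSum TΩ σ = (1 + x • (Q * termSum TG σ * P))⁻¹) :
    termSum (recombTerm TG (sandTerm P Q TΩ) x) σ =
      termSum TG σ - x • (termSum TG σ * (P * (1 + x • (Q * termSum TG σ * P))⁻¹ * Q) * termSum TG σ) := by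
  rw [termSum_recomb' hG (rowData_sandwich hΩ hP hQ hw hR) hw hR x hσ, termSum_sandwich hΩ hP hQ hw hR hσ, hΩsum]
  simp only [Matrix.mul_assoc]

end SumForm

/-! ## §2 The constrained Woodbury identity in the siblings' shape -/

section Tilt

variable {μ : Type*} [Fintype μ] [DecidableEq μ]

/-- **`flucCov (K + Rᵀ(x·1)R) Q̃ = 𝒢 − x·(𝒢(Rᵀ(1 + x·R𝒢Rᵀ)⁻¹R)𝒢)`, `𝒢 = flucCov K Q̃`** — b09's constrained Woodbury
`B9SectECov.flucCov_add_tilt` at `V = x·1`, with `((x·1)⁻¹ + R𝒢Rᵀ)⁻¹ = x·(1 + x·R𝒢Rᵀ)⁻¹` (an4's `inv_smul_one_add`).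
Hypotheses: the bordered matrix of `(K, Q̃)` nonsingular (`K` may be singular), `x ≠ 0`, `1 + x·R𝒢Rᵀ` invertible.
[cite: Balaban1985BackgroundPropagators, (3.186) p.432] -/
theorem flucCov_tilt_eq (K : Matrix Y Y ℂ) (Qt : Matrix μ Y ℂ) (Rm : Matrix Y Y ℂ) {x : ℂ} (hx : x ≠ 0)
    (hW : IsUnit (kkt K Qt).det) (hS : IsUnit (1 + x • (Rm * flucCov K Qt * Rmᵀ))) :
    flucCov (K + Rmᵀ * (x • (1 : Matrix Y Y ℂ)) * Rm) Qt =
      flucCov K Qt - x • (flucCov K Qt * (Rmᵀ * (1 + x • (Rm * flucCov K Qt * Rmᵀ))⁻¹ * Rm) * flucCov K Qt) := by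
  have hV : IsUnit (x • (1 : Matrix Y Y ℂ)).det := by
    rw [Matrix.det_smul, Matrix.det_one, mul_one]
    exact (pow_ne_zero _ hx).isUnit
  have hM : IsUnit ((x • (1 : Matrix Y Y ℂ))⁻¹ + Rm * flucCov K Qt * Rmᵀ).det :=
    (Matrix.isUnit_iff_isUnit_det _).1 (isUnit_inv_smul_one_add _ hx hS)
  rw [flucCov_add_tilt K Qt Rm (x • (1 : Matrix Y Y ℂ)) hW hV hM, inv_smul_one_add _ hx hS]
  simp only [Matrix.mul_smul, Matrix.smul_mul, Matrix.mul_assoc]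

variable {TG : W → ℂ → Matrix Y Y ℂ} {mG : W → Y → Y → ℝ} {ρG : ℝ}
  {TΩ : V → ℂ → Matrix Y Y ℂ} {mΩ : V → Y → Y → ℝ} {ρΩ : ℝ} {Rm : Matrix Y Y ℂ} {cP cQ : ℝ}

/-- **THEOREM A level: the recombined family sums to the TILTED CONSTRAINED COVARIANCE.**  If the `G`-family sums at `σ`
to `flucCov K Q̃` (= G̃₂, (3.186)) and the unit-lattice family to `(1 + x·R·G̃₂·Rᵀ)⁻¹`, then the recombined family (with
sandwich `P = Rᵀ`, `Q = R`) sums to `flucCov (K + Rᵀ(x·1)R) Q̃` (= G̃₃(x) of [II] p. 13) — rider (ρ1) void.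
[cite: Balaban1988RG2Cluster, p.13 after (2.7)] -/
theorem termSum_resolvent_flucCov [Nonempty Y] (hG : RowData κ d R TG mG ρG) (hΩ : RowData κ d R TΩ mΩ ρΩ)
    (hP : WRS κ d Rmᵀ cP) (hQ : WRS κ d Rm cQ) (hw : WeightHyp κ d) (hR : 0 < R) {x : ℂ} (hx : x ≠ 0) {σ : ℂ}
    (hσ : σ ∈ ball (0 : ℂ) R) (K : Matrix Y Y ℂ) (Qt : Matrix μ Y ℂ) (hW : IsUnit (kkt K Qt).det)
    (hGsum : termSum TG σ = flucCov K Qt) (hS : IsUnit (1 + x • (Rm * flucCov K Qt * Rmᵀ)))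
    (hΩsum : termSum TΩ σ = (1 + x • (Rm * termSum TG σ * Rmᵀ))⁻¹) :
    termSum (recombTerm TG (sandTerm Rmᵀ Rm TΩ) x) σ = flucCov (K + Rmᵀ * (x • (1 : Matrix Y Y ℂ)) * Rm) Qt := by
  rw [termSum_resolvent_eq hG hΩ hP hQ hw hR x hσ hΩsum, hGsum, flucCov_tilt_eq K Qt Rm hx hW hS]

end Tilt

/-! ## §3 THEOREM B level: the END-TO-END family sums to G̃₃(x) = `flucCov (K + Rᵀ(x·1)R) Q̃` at `s ≡ 1` -/

section TheoremB

variable {B Ω Δ μ : Type*} [Fintype B] [Fintype Ω] [DecidableEq Ω] [DecidableEq Δ] [Fintype μ] [DecidableEq μ]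

/-- **RIDER (ρ1) ELIMINATED, THEOREM B LEVEL.**  The binders of `AnalyticWalkSum216RowResolventOmega.termSum_resolventΩ_one`
with the sandwich specialised to `P = Rᵀ`, `Q = R` and «`Σ_ω G_ω` invertible» REPLACED by «`Σ_ω G_ω = flucCov K Q̃`» (the
pieces are those of G̃₂'s own expansion — [13] (3.185)∕Thm 3.15's object; `flucCov` = b09's bordered-inverse block, `K`
may be singular, only the bordered matrix nonsingular): at `τ ≡ 1`, `σ = 1` the recombined family SUMS to
`flucCov (K + Rᵀ(x·1)R) Q̃` — the covariance of the x-tilted form about the SAME constraint, i.e. the G̃₃(x) of [II]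
p. 13 (b09 `b10_rep63_of_3185` then gives B10 (63)'s `C(C*Δ_kC + x)⁻¹C*`).  Chain: `resummation_identity₂` +
`wrs_Rem₂_le` + `termSum_decFamilyΩ_one` + `inv_one_add_eq'` (siblings ∕ d4-p3) + §1 + b09's `flucCov_add_tilt` BY NAME.
[cite: Balaban1988RG2Cluster, p.13 after (2.7)] -/
theorem termSum_resolventΩ_flucCov [Nonempty Y] (hw : WeightHyp κ d) (hsymm : ∀ a b, d a b = d b a)
    (G : Ω → Matrix Y Y ℂ) (DG : Ω → Finset Δ) {κ₁ ρG : ℝ} (hκ₁ : 0 < κ₁)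
    (hG : ∀ i, ∑ j, (∑ ω, pieceMaj κ₁ G DG ω i j) * Real.exp (κ * d i j) ≤ ρG)
    (Rm : Matrix Y Y ℂ) {cP cQ : ℝ} (hP : WRS κ d Rmᵀ cP) (hQ : WRS κ d Rm cQ) {x : ℂ} {X : ℝ} (hx : ‖x‖ ≤ X)
    (hx0 : x ≠ 0) (K : Matrix Y Y ℂ) (Qt : Matrix μ Y ℂ) (hKkt : IsUnit (kkt K Qt).det) (hGsum : Ktot G = flucCov K Qt)
    (Dω : Ω → Finset Y) (hKdom : ∀ ω k l, (Rm * G ω * Rmᵀ) k l ≠ 0 → k ∈ Dω ω) (near : B → Finset Ω)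
    (h : B → Y → ℝ) (E : B → Finset Y) (L : B → Matrix Y Y ℂ) (hsupp : ∀ b y, y ∉ E b → h b y = 0)
    (habs : ∀ b y, |h b y| ≤ 1) (hsum2 : ∀ y, ∑ b, h b y ^ 2 = 1) (hPL : ∀ b, Pj E b * L b = L b)
    (hloc : ∀ b, Pj E b * (1 + Knear (pieceK Rm Rmᵀ G x) near b) * Pj E b * L b = Pj E b)
    {M N C_L K₁ Φ r D Df Rr : ℝ} (hM : 0 < M)
    (hLip : ∀ b y y', |h b y - h b y'| ≤ d y y' / M) (hN : ∀ y, ((Finset.univ.filter fun b => y ∈ E b).card : ℝ) ≤ N)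
    (hC : 0 ≤ C_L) (hr : 0 < r) (hRD : r + D ≤ Rr) (hRf : r + Df ≤ Rr) (hDf : 0 ≤ Df) (cellOf : Y → Δ) {Pk : ℕ}
    (hpack : ∀ a : Y, ∃ S : Finset Δ, S.card ≤ Pk ∧ ∀ z, d a z ≤ Rr → cellOf z ∈ S)
    (hdiam : ∀ b, ∀ z ∈ E b, ∀ z' ∈ E b, d z z' ≤ D) (thr : Ω → List Y)
    (hthr : ∀ ω, ∀ z ∈ Dω ω, ∃ p ∈ thr ω, d z p ≤ Df) (cr : Ω → ℝ) (hcr : ∀ ω, 3 * listLen d (thr ω) + 2 * Df ≤ cr ω)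
    (hL : ∀ b, WRS (κ + κ₁ * (Pk / r)) d (L b) C_L)
    (hK₁ : ∀ k, ∑ ω, ∑ l, ‖(Rm * G ω * Rmᵀ) k l‖ * d k l
      * Real.exp ((κ + κ₁ * (Pk / r)) * d k l + κ₁ * (Pk / r) * cr ω) ≤ K₁)
    (hΦ : ∀ k, ∑ ω, ∑ l, (∑ b, if ω ∈ near b then (0 : ℝ) else |h b l|) * ‖(Rm * G ω * Rmᵀ) k l‖
      * Real.exp ((κ + κ₁ * (Pk / r)) * d k l + κ₁ * (Pk / r) * cr ω) ≤ Φ)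
    (hρX : C_L * (2 * N / M * (X * K₁) + X * Φ) < 1) (Δ₀ : Δ) :
    termSum (recombTerm (decPieces G DG (fun _ => (1 : ℂ)) Δ₀)
        (sandTerm Rmᵀ Rm (decFamilyΩ cellOf E Dω h (pieceK Rm Rmᵀ G x) near L (fun _ => (1 : ℂ)) Δ₀)) x) 1
      = flucCov (K + Rmᵀ * (x • (1 : Matrix Y Y ℂ)) * Rm) Qt := by
  have hf0 : ∀ (ω : Ω) (l : Y) (b : B), 0 ≤ (if ω ∈ near b then (0 : ℝ) else |h b l|) := fun ω l b => by
    split_ifs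
    · exact le_rfl
    · exact abs_nonneg _
  have hτ : ∀ δ : Δ, ‖(fun _ => (1 : ℂ)) δ‖ ≤ Real.exp κ₁ := fun _ => by
    rw [norm_one]
    exact Real.one_le_exp hκ₁.le
  have h1 : (1 : ℂ) ∈ ball (0 : ℂ) (Real.exp κ₁) := by
    rw [mem_ball_zero_iff, norm_one]
    exact Real.one_lt_exp_iff.2 hκ₁
  have hδ : 0 ≤ κ₁ * (Pk / r) := mul_nonneg hκ₁.le (div_nonneg (Nat.cast_nonneg Pk) hr.le)
  have hcr0 : ∀ ω, 0 ≤ cr ω := fun ω =>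
    le_trans (add_nonneg (mul_nonneg (by norm_num) (listLen_nonneg d hw.nonneg (thr ω)))
      (mul_nonneg (by norm_num) hDf)) (hcr ω)
  -- the two halves' row data (siblings ∕ d4-p3 BY NAME)
  have hGr := rowData_decPieces G DG hG (fun _ => (1 : ℂ)) hτ Δ₀ (κ := κ) (d := d)
  have hΩ := rowData_decFamilyΩ hw hsymm (pieceK Rm Rmᵀ G x) Dω (pieceK_dom hKdom x) near h E L hsupp habs hM hLip
    hN hC hκ₁.le hr hRD hRf cellOf hpack hdiam thr hthr cr hcr hL (budgetK₁_scale hx hw.nonneg hK₁)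
    (budgetΦ_scale hx hf0 hΦ) hρX (fun _ => (1 : ℂ)) hτ Δ₀
  -- d4-p3's resummation identity, the remainder smallness, and the identification of the Ω-family at s ≡ 1
  have hid := resummation_identity₂ (pieceK Rm Rmᵀ G x) near h E L hsum2 hsupp hPL hloc
  have hRem := wrs_Rem₂_le hw hδ cr hcr0 (pieceK Rm Rmᵀ G x) near h E L hsupp habs hM hLip hN hC hL
    (budgetK₁_scale hx hw.nonneg hK₁) (budgetΦ_scale hx hf0 hΦ)
  have hΩ1 := termSum_decFamilyΩ_one hw hid hRem hρX cellOf E Dω Δ₀ hΩ h1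
  have hSu : IsUnit (1 + x • (Rm * Ktot G * Rmᵀ)) := by
    rw [← Ktot_pieceK]
    exact (inv_one_add_eq' hw hid hRem hρX).1
  have hG1 : termSum (decPieces G DG (fun _ => (1 : ℂ)) Δ₀) 1 = Ktot G := termSum_decPieces_one G DG Δ₀
  rw [Ktot_pieceK, ← hG1] at hΩ1
  rw [hGsum] at hSu
  have hGsum' : termSum (decPieces G DG (fun _ => (1 : ℂ)) Δ₀) 1 = flucCov K Qt := by rw [hG1, hGsum]
  exact termSum_resolvent_flucCov hGr hΩ hP hQ hw (Real.exp_pos κ₁) hx0 h1 K Qt hKkt hGsum' hSu hΩ1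

end TheoremB

/-! ## §4 Non-vacuity at THEOREM A level -/

/-- §2's algebraic bridge is inhabited and type-checks on concrete data: `K = 1` on one site, ANY constraint `Q̃` with
nonsingular bordered matrix, the zero tilt direction `R = 0`, any `x ≠ 0` (the invertibility input is `1 + 0 = 1`).  The
joint satisfiability of the THEOREM-B binder list is the siblings' `AnalyticWalkSum216RowResolventOmega.Witness`. [folklore] -/
example {μ : Type*} [Fintype μ] [DecidableEq μ] (Qt : Matrix μ Unit ℂ) (hW : IsUnit (kkt (1 : Matrix Unit Unit ℂ) Qt).det)
    {x : ℂ} (hx : x ≠ 0) :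
    flucCov ((1 : Matrix Unit Unit ℂ) + (0 : Matrix Unit Unit ℂ)ᵀ * (x • (1 : Matrix Unit Unit ℂ)) * 0) Qt =
      flucCov 1 Qt - x • (flucCov 1 Qt * ((0 : Matrix Unit Unit ℂ)ᵀ *
        (1 + x • ((0 : Matrix Unit Unit ℂ) * flucCov 1 Qt * (0 : Matrix Unit Unit ℂ)ᵀ))⁻¹ * 0) * flucCov 1 Qt) :=
  flucCov_tilt_eq 1 Qt 0 hx hW (by rw [Matrix.zero_mul, Matrix.zero_mul, smul_zero, add_zero]; exact isUnit_one)

end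

end Summit.QuantumFields.BalabanUV.Beta.AnalyticWalkSum216RowResolventProj
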